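import Literature.NumberTheory.Automorphic.UnboundedDenominatorsDegreeProofs
import HarnessLib

/-!
# The unbounded denominators theorem (Calegari–Dimitrov–Tang) — §6.3: the inputs in printed form

PROOF-ONLY sequel (no definition, no named fact; D-0026) of
`UnboundedDenominatorsAssemblyProofs.lean` (`CalegariDimitrovTang2025_unboundedDenominators.of_inputs`:
Theorem 1.0.1 from `hker₂`, `hcor`, `hrat`, finiteness, and the logarithmic gap
`[R_N : M_N] ≤ C log N`). Source: F. Calegari, V. Dimitrov, Y. Tang, *The unbounded denominators
conjecture*, J. Amer. Math. Soc. **38** (2025), 627–702 = arXiv:2109.09040, §4.3 displays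
(4.3.3)–(4.3.4) and §6.3. Here the two inputs that the assembly took in processed form are reduced
to their PRINTED shape:

* §1 `hrat_of_forall_exists_sum` — the rationality input `hrat N` (every `F/Δᵐ`, `F ∈ M_{12m}(Γ(N))`,
  lies in `M_N ⊗ ℂ = levelField N`) follows from the literal statement of Shimura's Theorem 3.52:
  every `F ∈ M_{12m}(Γ(N))` is a `ℂ`-linear combination of forms in `M_{12m}(Γ(N))` with rational-integer
  `q_N`-expansions;
* §2 `log_gap_of_degree_bounds` — CDT display (4.3.4): the logarithmic gap `[R_N : M_N] ≤ (C/c) log N`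
  follows from the degree formula (4.3.3) in the form `[M_N : M_2] ≥ c N³` (even `N`) and the
  dimension bound of Proposition 3.0.1 `[R_N : M_2] ≤ C N³ log N`, by the tower law
  `[R_N : M_2] = [R_N : M_N] [M_N : M_2]`;
* §3 ★ `CalegariDimitrovTang2025_unboundedDenominators.of_printed_inputs` — Theorem 1.0.1 from:
  `hker₂` (∀ `N > 0`, `p ∤ N`), `hcor` (∀ `N`), Shimura 3.52 (∀ `N > 0`), finite generation /
  finiteness, (4.3.3) as a lower bound and Proposition 3.0.1 as an upper bound (all hypotheses
  guarded by `0 < N`).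

## References

* [CalegariDimitrovTang2025] F. Calegari, V. Dimitrov, Y. Tang, The unbounded denominators
  conjecture, J. Amer. Math. Soc. 38 (2025), no. 3, 627–702; arXiv:2109.09040. §4.3
  ((4.3.3)–(4.3.4), Proposition 4.3.5), §6.3; Proposition 3.0.1.
* G. Shimura, Introduction to the arithmetic theory of automorphic functions (1971), Theorem 3.52.
-/

noncomputable section

namespace Literature.NumberTheory.Automorphic

open scoped MatrixGroups ModularForm Manifold
open UpperHalfPlane CongruenceSubgroup Matrix.SpecialLinearGroup ModularGroup

namespace UnboundedDenominators

/-! ### §1. The rationality input from Shimura's Theorem 3.52 -/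

/-- **`hrat` from Shimura 3.52.** If every weight-`12m` modular form on `Γ(N)` (`N > 0`) is a finite
`ℂ`-linear combination of weight-`12m` forms on `Γ(N)` with rational-integer `q_N`-expansion
coefficients (G. Shimura, *Introduction to the arithmetic theory of automorphic functions*, Thm 3.52:
"`M_k(Γ_N)` has a basis consisting of elements whose Fourier coefficients with respect to
`e^{2πiz/N}` are rational integers"), then every `F/Δᵐ`, `F ∈ M_{12m}(Γ(N))`, lies in
`levelField N` (the field generated by the INTEGRAL generators) — the hypothesis `hrat N` of
`CalegariDimitrovTang2025_unboundedDenominators.of_inputs`. [cite: CalegariDimitrovTang2025,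
Lemma 4.2.3 ("`M_N` may be identified with the field of rational functions on `Y(N)/ℚ`")] -/
theorem hrat_of_forall_exists_sum {N : ℕ} (hN : 0 < N)
    (hShimura : ∀ (m : ℕ) (F : ModularForm ((Gamma N : Subgroup SL(2, ℤ)) : Subgroup (GL (Fin 2) ℝ))
      (12 * (m : ℤ))), ∃ (ι : Type) (_ : Fintype ι) (c : ι → ℂ)
      (B : ι → ModularForm ((Gamma N : Subgroup SL(2, ℤ)) : Subgroup (GL (Fin 2) ℝ)) (12 * (m : ℤ))),
      (∀ i (n : ℕ), ∃ z : ℤ, PowerSeries.coeff n (qExpansion (N : ℝ) (B i)) = (z : ℂ)) ∧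
      (F : ℍ → ℂ) = ∑ i, c i • (B i : ℍ → ℂ))
    (m : ℕ) (F : ModularForm ((Gamma N : Subgroup SL(2, ℤ)) : Subgroup (GL (Fin 2) ℝ)) (12 * (m : ℤ))) :
    algebraMap hol Mer (modFun m F) ∈ levelField N := by
  haveI : NeZero N := ⟨hN.ne'⟩
  obtain ⟨ι, _, c, B, hBint, hF⟩ := hShimura m F
  -- `F/Δᵐ = ∑ cᵢ • Bᵢ/Δᵐ` in `𝓗`
  have hsum : modFun m F = ∑ i, c i • modFun m (B i) := by
    apply Subtype.ext
    funext τ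
    rw [modFun_apply, hF, Finset.sum_apply, Finset.sum_div, AddSubmonoidClass.coe_finsetSum,
      Finset.sum_apply]
    refine Finset.sum_congr rfl fun i _ ↦ ?_
    rw [Subalgebra.coe_smul, Pi.smul_apply, Pi.smul_apply, smul_eq_mul, smul_eq_mul, modFun_apply,
      mul_div_assoc]
  rw [hsum, map_sum]
  refine sum_mem fun i _ ↦ ?_
  rw [Algebra.smul_def, map_mul, ← IsScalarTower.algebraMap_apply, ← Algebra.smul_def]
  have hmem : algebraMap hol Mer (modFun m (B i)) ∈ levelGens N :=
    ⟨Gamma N, inferInstance, m, B i, le_rfl, hBint i, rfl⟩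
  exact IntermediateField.smul_mem _ (IntermediateField.subset_adjoin ℂ _ hmem)

/-! ### §2. The logarithmic gap (4.3.4) from (4.3.3) and Proposition 3.0.1 -/

/-- **CDT display (4.3.4) from (4.3.3) and the dimension bound** [cite: CalegariDimitrovTang2025,
§4.3 displays (4.3.3)–(4.3.4) and Proposition 4.3.5]: if `[M_N : M_2] ≥ c N³` (`c > 0`; CDT (4.3.3):
`= ½[Γ(2):Γ(N)] > N³/12ζ(2)`) and `[R_N : M_2] ≤ C N³ log N` (Proposition 3.0.1) for even `N > 0`,
then `[R_N : M_N] ≤ (C/c) log N` — since `[R_N : M_2] = [M_N : M_2] · [R_N : M_N]`. Degrees are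
`IntermediateField.relfinrank` of the tree's `levelField`/`bddDenField`. -/
theorem log_gap_of_degree_bounds {c C : ℝ} (hc : 0 < c)
    (hdeg : ∀ N : ℕ, 0 < N → Even N →
      c * (N : ℝ) ^ 3 ≤ IntermediateField.relfinrank (levelField 2) (levelField N))
    (hhol : ∀ N : ℕ, 0 < N → Even N →
      (IntermediateField.relfinrank (levelField 2) (bddDenField N) : ℝ) ≤ C * (N : ℝ) ^ 3 * Real.log N)
    (N : ℕ) (hN : 0 < N) (heven : Even N) :
    (IntermediateField.relfinrank (levelField N) (bddDenField N) : ℝ) ≤ C / c * Real.log N := by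
  have h2N : levelField 2 ≤ levelField N := levelField_mono two_pos heven.two_dvd hN.ne'
  have htower := IntermediateField.relfinrank_mul_relfinrank h2N (levelField_le_bddDenField N)
  set d := IntermediateField.relfinrank (levelField 2) (levelField N) with hd
  set r := IntermediateField.relfinrank (levelField N) (bddDenField N) with hr
  have hN3 : (0 : ℝ) < (N : ℝ) ^ 3 := by positivity
  have hdpos : (0 : ℝ) < d := lt_of_lt_of_le (by positivity) (hdeg N hN heven)
  have hprod : (d : ℝ) * r ≤ C * (N : ℝ) ^ 3 * Real.log N := by
    have := hhol N hN heven
    rw [← htower, Nat.cast_mul] at this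
    exact this
  have hr0 : (0 : ℝ) ≤ r := Nat.cast_nonneg _
  -- `r ≤ (C N³ log N)/d ≤ (C N³ log N)/(c N³)`
  have hCpos : 0 ≤ C * (N : ℝ) ^ 3 * Real.log N := le_trans (by positivity) hprod
  calc (r : ℝ) = (d : ℝ) * r / d := by field_simp
    _ ≤ C * (N : ℝ) ^ 3 * Real.log N / d := by gcongr
    _ ≤ C * (N : ℝ) ^ 3 * Real.log N / (c * (N : ℝ) ^ 3) :=
        div_le_div_of_nonneg_left hCpos (by positivity) (hdeg N hN heven)
    _ = C / c * Real.log N := by field_simp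

/-! ### §3. Theorem 1.0.1 from the printed inputs -/

/-- ★ **CDT Theorem 1.0.1 from its printed inputs** [cite: CalegariDimitrovTang2025, §6.3]: the named
fact `CalegariDimitrovTang2025_unboundedDenominators` follows from
(1) `hker₂`: for `N > 0` and primes `p ∤ N`, the amalgam + congruence subgroup property sentence for
`SL₂(ℤ[1/p])` (Lemma 4.4.1/4.6.2); (2) `hcor`: Corollary 4.5.3 for every `N`;
(3) Shimura's Theorem 3.52 for `Γ(N)`, `N > 0` (rational-integral spanning set of `M_{12m}(Γ(N))`);
(4) finite generation of `R_N` and finiteness of `[R_{N'} : M_N]` (`N ∣ N'`);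
(5) the degree formula (4.3.3) as `[M_N : M_2] ≥ c N³` and (6) Proposition 3.0.1 as
`[R_N : M_2] ≤ C N³ log N`, for even `N`. Everything else (§§4.1–4.3 field and group bookkeeping,
the leveraging of Proposition 4.3.5, §6.3) is proved in the tree. -/
theorem _root_.Literature.NumberTheory.Automorphic.CalegariDimitrovTang2025_unboundedDenominators.of_printed_inputs
    (hker₂ : ∀ (N p : ℕ) (A : GL (Fin 2) ℝ), 0 < N →
      (A : Matrix (Fin 2) (Fin 2) ℝ) = !![(p : ℝ), 0; 0, 1] → p.Prime → ¬ p ∣ N →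
      ∀ (Δ : Type) [Group Δ] [Finite Δ] (g₁ g₂ : Gamma N →* Δ),
      (∀ (x : SL(2, ℤ)) (hx : x ∈ Gamma N), x ∈ Gamma0 p → ∀ (y : SL(2, ℤ)) (hy : y ∈ Gamma N),
        A * mapGL ℝ x = mapGL ℝ y * A → g₁ ⟨x, hx⟩ = g₂ ⟨y, hy⟩) →
      (∃ M : ℕ, M ≠ 0 ∧ ∀ (x : SL(2, ℤ)) (hx : x ∈ Gamma N), x ∈ Gamma M → g₁ ⟨x, hx⟩ = 1) ∧
      (∃ M : ℕ, M ≠ 0 ∧ ∀ (x : SL(2, ℤ)) (hx : x ∈ Gamma N), x ∈ Gamma M → g₂ ⟨x, hx⟩ = 1))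
    (hcor : ∀ (N : ℕ) (Q : Type) [CommGroup Q] [Finite Q] (θ : Gamma N →* Q),
      (∀ g : SL(2, ℤ), ∃ M : ℕ, M ≠ 0 ∧ ∀ (x : SL(2, ℤ)) (hx : x ∈ Gamma N)
        (hgx : g * x * g⁻¹ ∈ Gamma N), x ∈ Gamma M → θ ⟨g * x * g⁻¹, hgx⟩ = θ ⟨x, hx⟩) →
      ∃ M : ℕ, M ≠ 0 ∧ ∀ (x : SL(2, ℤ)) (hx : x ∈ Gamma N), x ∈ Gamma M → θ ⟨x, hx⟩ = 1)
    (hShimura : ∀ (N : ℕ), 0 < N → ∀ (m : ℕ)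
      (F : ModularForm ((Gamma N : Subgroup SL(2, ℤ)) : Subgroup (GL (Fin 2) ℝ)) (12 * (m : ℤ))),
      ∃ (ι : Type) (_ : Fintype ι) (c : ι → ℂ)
      (B : ι → ModularForm ((Gamma N : Subgroup SL(2, ℤ)) : Subgroup (GL (Fin 2) ℝ)) (12 * (m : ℤ))),
      (∀ i (n : ℕ), ∃ z : ℤ, PowerSeries.coeff n (qExpansion (N : ℝ) (B i)) = (z : ℂ)) ∧
      (F : ℍ → ℂ) = ∑ i, c i • (B i : ℍ → ℂ))
    (hfg : ∀ N : ℕ, 0 < N → (bddDenField N).FG)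
    (hfinite : ∀ N N' : ℕ, 0 < N → N ∣ N' →
      0 < IntermediateField.relfinrank (levelField N) (bddDenField N'))
    (hdeg : ∃ c : ℝ, 0 < c ∧ ∀ N : ℕ, 0 < N → Even N →
      c * (N : ℝ) ^ 3 ≤ IntermediateField.relfinrank (levelField 2) (levelField N))
    (hhol : ∃ C : ℝ, ∀ N : ℕ, 0 < N → Even N →
      (IntermediateField.relfinrank (levelField 2) (bddDenField N) : ℝ) ≤ C * (N : ℝ) ^ 3 * Real.log N) :
    CalegariDimitrovTang2025_unboundedDenominators := by
  obtain ⟨c, hc, hdeg⟩ := hdeg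
  obtain ⟨C, hhol⟩ := hhol
  refine CalegariDimitrovTang2025_unboundedDenominators.of_bddDenField_le_levelField
    fun N hN heven ↦ ?_
  -- leveraging on the even positive integers, as in `bddDenField_eq_levelField_of_inputs`
  let S : Set ℕ := {N | 0 < N ∧ Even N}
  have hS : ∀ N ∈ S, ∀ p : ℕ, p.Prime → ¬ p ∣ N → N * p ∈ S := fun N hNS p hp _ ↦
    ⟨Nat.mul_pos hNS.1 hp.pos, hNS.2.mul_right p⟩
  let r : ℕ → ℕ := fun N ↦ IntermediateField.relfinrank (levelField N) (bddDenField N)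
  have hdouble : ∀ N ∈ S, ∀ p : ℕ, p.Prime → ¬ p ∣ N → 1 < r N → 2 * r N ≤ r (N * p) := by
    intro N hNS p hp hpN h1
    obtain ⟨A, hA⟩ : ∃ A : GL (Fin 2) ℝ, (A : Matrix (Fin 2) (Fin 2) ℝ) = !![(p : ℝ), 0; 0, 1] :=
      ⟨Matrix.GeneralLinearGroup.mkOfDetNeZero !![(p : ℝ), 0; 0, 1]
        (by rw [Matrix.det_fin_two_of]; simp [hp.ne_zero]), rfl⟩
    have hNp : N.Coprime p := ((Nat.Prime.coprime_iff_not_dvd hp).mpr hpN).symm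
    have hNp0 : 0 < N * p := Nat.mul_pos hNS.1 hp.pos
    have hne : bddDenField N ≠ levelField N := by
      intro heq
      have : r N = 1 := by
        change IntermediateField.relfinrank (levelField N) (bddDenField N) = 1
        rw [heq, IntermediateField.relfinrank_self]
      omega
    exact two_mul_relfinrank_le hNS.1.ne' hp hNp hA (hker₂ N p A hNS.1 hA hp hpN) (hcor N)
      (hrat_of_forall_exists_sum hNS.1 (hShimura N hNS.1))
      (hrat_of_forall_exists_sum hNp0 (hShimura (N * p) hNp0)) (hfg N hNS.1)
      (hfinite N (N * p) hNS.1 (dvd_mul_right N p)) hne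
  have hle : r N ≤ 1 :=
    CalegariDimitrovTang2025_unboundedDenominators.le_one_of_log_bound_of_doubling hS r (C / c)
      (fun N hNS ↦ log_gap_of_degree_bounds hc hdeg hhol N hNS.1 hNS.2) hdouble N ⟨hN, heven⟩
      hN.ne'
  have hpos : 0 < r N := hfinite N N hN dvd_rfl
  have h1 : IntermediateField.relfinrank (levelField N) (bddDenField N) = 1 := by
    change r N = 1
    omega
  exact IntermediateField.relfinrank_eq_one_iff.mp h1

end UnboundedDenominators

end Literature.NumberTheory.Automorphic

end
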